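import Summits.Ventures.LatticeQCDFlow.Scoring.SUNWilsonLoopSecondMoment2D
import Summits.Ventures.LatticeQCDFlow.Scoring.UNWilsonLoopSecondMomentBounds
import HarnessLib

/-!
# Bounds and large-area limit of the Wilson-loop second moment in two-dimensional `SU(N)`: `−1/(N²−1) < P_adj(β) < 1`, `⟨|tr W_{R×T}|²⟩_β → 1`

HONEST FRAMING: exact (Metropolis-corrected) sampling algorithms for lattice gauge theory;
figures of merit are autocorrelation/cost numbers at stated couplings and volumes; no
continuum-physics claim.

Venture `LatticeQCDFlow` (cell pub-lqcd), sub-topic `Scoring`; FANOUT row 5 (`s0-sun-a`), GEN-21.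
NEW WORK of the cell (placement rule).  `SU(N)` twin of `UNWilsonLoopSecondMomentBounds`: with all one-plaquette integrals
over `SU(N)` and `D = Σ_q det[I_{|q+i−j|}(β)] = ∫_{SU(N)} e^{βRe tr u}du`, the normalised adjoint plaquette
`P_adj(β) = (M₂/D − 1)/(N² − 1)` of GEN-21's `SUNWilsonLoopSecondMoment2D` lies STRICTLY inside `(−1/(N²−1), 1)` for
every real `β` and `N ≥ 2` (`0 < M₂ < N²·D`; the witness of `|tr u| < N` in `SU(N)` is `diag(i, −i, 1, …, 1)`), so the
second moment `⟨|tr W_{R×T}|²⟩_β = 1 + (N²−1)·P_adj^{RT}` DECORRELATES to its Haar value `1`: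

* `specialUnitary_normSq_trace_weight_pos`, `specialUnitary_normSq_trace_weight_lt` — `0 < M₂ < N²·D`;
* **`specialUnitary_adjointPlaquette_mem_Ioo`**, **`abs_specialUnitary_adjointPlaquette_lt_one`**;
* **`tendsto_specialUnitary_wilsonLoop_secondMoment`** — `1 + (N²−1)·P_adj(β)ⁿ → 1` as `n = RT → ∞`.

No `def`, nothing cited as a fact, 0 sorry.
-/

noncomputable section

open MeasureTheory Filter Topology Finset
open Literature.MathematicalPhysics.QuantumFieldTheory
open Literature.Analysis.FunctionSpaces (besselI)

namespace Summit.Ventures.LatticeQCDFlow.Scoring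

section SUBounds

variable {N : ℕ}

/-- `|tr u|² ≤ N²` for `u ∈ U(N)` (entries of modulus `≤ 1`). -/
theorem normSq_trace_le_sq_card_su (u : Matrix.specialUnitaryGroup (Fin N) ℂ) :
    ‖((u : Matrix.specialUnitaryGroup (Fin N) ℂ) : Matrix (Fin N) (Fin N) ℂ).trace‖ ^ 2 ≤ (N : ℝ) ^ 2 := by
  have h : ‖((u : Matrix.specialUnitaryGroup (Fin N) ℂ) : Matrix (Fin N) (Fin N) ℂ).trace‖ ≤ N := by
    calc ‖((u : Matrix.specialUnitaryGroup (Fin N) ℂ) : Matrix (Fin N) (Fin N) ℂ).trace‖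
        = ‖∑ i, ((u : Matrix.specialUnitaryGroup (Fin N) ℂ) : Matrix (Fin N) (Fin N) ℂ) i i‖ := by rw [Matrix.trace]; rfl
      _ ≤ ∑ i, ‖((u : Matrix.specialUnitaryGroup (Fin N) ℂ) : Matrix (Fin N) (Fin N) ℂ) i i‖ := norm_sum_le _ _
      _ ≤ ∑ _i : Fin N, (1 : ℝ) := Finset.sum_le_sum fun i _ => entry_norm_bound_of_unitary (Matrix.specialUnitaryGroup_le_unitaryGroup u.2) i i
      _ = N := by simp
  exact pow_le_pow_left₀ (norm_nonneg _) h 2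

/-- The weighted second moment is integrable data: `u ↦ |tr u|² e^{βRe tr u}` is continuous on the compact `U(N)`. -/
theorem continuous_normSq_trace_mul_weight_su (β : ℝ) :
    Continuous fun u : Matrix.specialUnitaryGroup (Fin N) ℂ =>
      ‖((u : Matrix.specialUnitaryGroup (Fin N) ℂ) : Matrix (Fin N) (Fin N) ℂ).trace‖ ^ 2 *
        Real.exp (β * ((u : Matrix.specialUnitaryGroup (Fin N) ℂ) : Matrix (Fin N) (Fin N) ℂ).trace.re) := by
  have htr : Continuous fun u : Matrix.specialUnitaryGroup (Fin N) ℂ =>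
      ((u : Matrix.specialUnitaryGroup (Fin N) ℂ) : Matrix (Fin N) (Fin N) ℂ).trace :=
    continuous_subtype_val.matrix_trace
  exact (htr.norm.pow 2).mul (Real.continuous_exp.comp (continuous_const.mul (Complex.continuous_re.comp htr)))

/-- **`M₂ < N²·D`**: `∫|tr u|²e^{βRe tr u}du < N²·det[I_{|i−j|}(β)]` (`N ≥ 2`; the deficit `N² − |tr u|²` is
non-negative, continuous, and positive at `u = diag(−1, 1, …, 1)`, a point of the support of Haar measure). -/
theorem specialUnitary_normSq_trace_weight_lt (hN : 2 ≤ N) (β : ℝ) :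
    (∫ u, ‖((u : Matrix.specialUnitaryGroup (Fin N) ℂ) : Matrix (Fin N) (Fin N) ℂ).trace‖ ^ 2 *
        Real.exp (β * ((u : Matrix.specialUnitaryGroup (Fin N) ℂ) : Matrix (Fin N) (Fin N) ℂ).trace.re)
        ∂(haarProbability (Matrix.specialUnitaryGroup (Fin N) ℂ))) <
      (N : ℝ) ^ 2 * ∑' q : ℤ, (Matrix.of fun i j : Fin N => besselI (q + (i : ℤ) - (j : ℤ)).natAbs β).det := by
  haveI : NeZero N := ⟨by omega⟩
  haveI : (haarProbability (Matrix.specialUnitaryGroup (Fin N) ℂ)).IsHaarMeasure := Measure.isHaarMeasure_haarMeasure ⊤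
  set μ := haarProbability (Matrix.specialUnitaryGroup (Fin N) ℂ) with hμ
  have htr : Continuous fun u : Matrix.specialUnitaryGroup (Fin N) ℂ =>
      ((u : Matrix.specialUnitaryGroup (Fin N) ℂ) : Matrix (Fin N) (Fin N) ℂ).trace :=
    continuous_subtype_val.matrix_trace
  have hw : Continuous fun u : Matrix.specialUnitaryGroup (Fin N) ℂ =>
      Real.exp (β * ((u : Matrix.specialUnitaryGroup (Fin N) ℂ) : Matrix (Fin N) (Fin N) ℂ).trace.re) :=
    Real.continuous_exp.comp (continuous_const.mul (Complex.continuous_re.comp htr))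
  -- the deficit integrand
  set g : Matrix.specialUnitaryGroup (Fin N) ℂ → ℝ := fun u =>
    ((N : ℝ) ^ 2 - ‖((u : Matrix.specialUnitaryGroup (Fin N) ℂ) : Matrix (Fin N) (Fin N) ℂ).trace‖ ^ 2) *
      Real.exp (β * ((u : Matrix.specialUnitaryGroup (Fin N) ℂ) : Matrix (Fin N) (Fin N) ℂ).trace.re) with hg
  have hgc : Continuous g := (continuous_const.sub (htr.norm.pow 2)).mul hw
  have hg_int : Integrable g μ := hgc.integrable_of_hasCompactSupport (HasCompactSupport.of_compactSpace _)
  have hg_nonneg : ∀ u, 0 ≤ g u := fun u =>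
    mul_nonneg (sub_nonneg.2 (normSq_trace_le_sq_card_su u)) (Real.exp_pos _).le
  -- positivity of the deficit: the open set `{|tr u|² < N²}` contains `diag(−1, 1, …, 1)`
  have hopen : IsOpen {u : Matrix.specialUnitaryGroup (Fin N) ℂ |
      ‖((u : Matrix.specialUnitaryGroup (Fin N) ℂ) : Matrix (Fin N) (Fin N) ℂ).trace‖ ^ 2 < (N : ℝ) ^ 2} :=
    isOpen_lt (htr.norm.pow 2) continuous_const
  -- the witness `diag(i, −i, 1, …, 1) ∈ SU(N)` (the tree's `pairFun 0 1 I`), of trace `N − 2`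
  set p0 : Fin N := ⟨0, by omega⟩ with hp0
  set p1 : Fin N := ⟨1, by omega⟩ with hp1
  have h01 : p0 ≠ p1 := by
    intro h; have := congrArg Fin.val h; simp [hp0, hp1] at this
  set d : Fin N → ℂ := Literature.MathematicalPhysics.QuantumLattice.pairFun p0 p1 Complex.I with hd
  have hdU : Matrix.diagonal d ∈ Matrix.specialUnitaryGroup (Fin N) ℂ := by
    rw [Literature.MathematicalPhysics.QuantumLattice.diagonal_mem_specialUnitaryGroup_iff]
    refine ⟨fun i => ?_, Literature.MathematicalPhysics.QuantumLattice.prod_pairFun p0 p1 Complex.I Complex.I_ne_zero⟩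
    simp only [hd, Literature.MathematicalPhysics.QuantumLattice.pairFun, Pi.mul_apply, Pi.mulSingle_apply]
    split_ifs <;> simp
  have htrd : (Matrix.diagonal d).trace = (N : ℂ) - 2 := by
    have e : ∀ i : Fin N, d i = 1 + ((if i = p0 then Complex.I - 1 else 0) + (if i = p1 then -Complex.I - 1 else 0)) := by
      intro i
      simp only [hd, Literature.MathematicalPhysics.QuantumLattice.pairFun, Pi.mul_apply, Pi.mulSingle_apply, Complex.inv_I]
      by_cases h0 : i = p0
      · subst h0; simp [h01]
      · by_cases h1 : i = p1
        · subst h1; simp [h0]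
        · simp [h0, h1]
    rw [Matrix.trace_diagonal]
    simp_rw [e]
    rw [Finset.sum_add_distrib, Finset.sum_add_distrib, Finset.sum_const, Finset.card_univ, Fintype.card_fin,
      Finset.sum_ite_eq' Finset.univ p0, Finset.sum_ite_eq' Finset.univ p1, if_pos (Finset.mem_univ _),
      if_pos (Finset.mem_univ _), nsmul_eq_mul, mul_one]
    ring
  have hpos : 0 < μ {u : Matrix.specialUnitaryGroup (Fin N) ℂ |
      ‖((u : Matrix.specialUnitaryGroup (Fin N) ℂ) : Matrix (Fin N) (Fin N) ℂ).trace‖ ^ 2 < (N : ℝ) ^ 2} := by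
    refine hopen.measure_pos μ ⟨⟨Matrix.diagonal d, hdU⟩, ?_⟩
    simp only [Set.mem_setOf_eq]
    rw [htrd, show ((N : ℂ) - 2) = (((N : ℝ) - 2 : ℝ) : ℂ) by push_cast; rfl, Complex.norm_real,
      Real.norm_eq_abs, sq_abs]
    have h2 : (2 : ℝ) ≤ N := by exact_mod_cast hN
    nlinarith
  have hgap : 0 < ∫ u, g u ∂μ := by
    rw [integral_pos_iff_support_of_nonneg hg_nonneg hg_int]
    refine hpos.trans_le (measure_mono fun u hu => ?_)
    simp only [Set.mem_setOf_eq] at hu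
    simp only [Function.mem_support, hg]
    exact (mul_pos (sub_pos.2 hu) (Real.exp_pos _)).ne'
  -- `∫ g = N² D − M₂`
  have hM2_int : Integrable (fun u : Matrix.specialUnitaryGroup (Fin N) ℂ =>
      ‖((u : Matrix.specialUnitaryGroup (Fin N) ℂ) : Matrix (Fin N) (Fin N) ℂ).trace‖ ^ 2 *
        Real.exp (β * ((u : Matrix.specialUnitaryGroup (Fin N) ℂ) : Matrix (Fin N) (Fin N) ℂ).trace.re)) μ :=
    (continuous_normSq_trace_mul_weight_su β).integrable_of_hasCompactSupport (HasCompactSupport.of_compactSpace _)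
  have hw_int : Integrable (fun u : Matrix.specialUnitaryGroup (Fin N) ℂ =>
      Real.exp (β * ((u : Matrix.specialUnitaryGroup (Fin N) ℂ) : Matrix (Fin N) (Fin N) ℂ).trace.re)) μ :=
    hw.integrable_of_hasCompactSupport (HasCompactSupport.of_compactSpace _)
  have hsplit : ∫ u, g u ∂μ = (N : ℝ) ^ 2 * ∑' q : ℤ, (Matrix.of fun i j : Fin N => besselI (q + (i : ℤ) - (j : ℤ)).natAbs β).det -
      ∫ u, ‖((u : Matrix.specialUnitaryGroup (Fin N) ℂ) : Matrix (Fin N) (Fin N) ℂ).trace‖ ^ 2 *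
        Real.exp (β * ((u : Matrix.specialUnitaryGroup (Fin N) ℂ) : Matrix (Fin N) (Fin N) ℂ).trace.re) ∂μ := by
    rw [← integral_haar_specialUnitaryGroup_fin_exp_mul_trace_re N β, ← integral_const_mul, ← integral_sub (hw_int.const_mul _) hM2_int]
    exact integral_congr_ae (ae_of_all _ fun u => by simp only [hg]; ring)
  linarith [hgap, hsplit]

/-- **`0 < M₂`**: `0 < ∫|tr u|²e^{βRe tr u}du` (`N ≥ 1`; the integrand is non-negative, continuous and positive at `u = 1`). -/
theorem specialUnitary_normSq_trace_weight_pos (hN : 1 ≤ N) (β : ℝ) :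
    0 < ∫ u, ‖((u : Matrix.specialUnitaryGroup (Fin N) ℂ) : Matrix (Fin N) (Fin N) ℂ).trace‖ ^ 2 *
        Real.exp (β * ((u : Matrix.specialUnitaryGroup (Fin N) ℂ) : Matrix (Fin N) (Fin N) ℂ).trace.re)
        ∂(haarProbability (Matrix.specialUnitaryGroup (Fin N) ℂ)) := by
  haveI : NeZero N := ⟨by omega⟩
  haveI : (haarProbability (Matrix.specialUnitaryGroup (Fin N) ℂ)).IsHaarMeasure := Measure.isHaarMeasure_haarMeasure ⊤
  set μ := haarProbability (Matrix.specialUnitaryGroup (Fin N) ℂ) with hμ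
  have htr : Continuous fun u : Matrix.specialUnitaryGroup (Fin N) ℂ =>
      ((u : Matrix.specialUnitaryGroup (Fin N) ℂ) : Matrix (Fin N) (Fin N) ℂ).trace :=
    continuous_subtype_val.matrix_trace
  have hint : Integrable (fun u : Matrix.specialUnitaryGroup (Fin N) ℂ =>
      ‖((u : Matrix.specialUnitaryGroup (Fin N) ℂ) : Matrix (Fin N) (Fin N) ℂ).trace‖ ^ 2 *
        Real.exp (β * ((u : Matrix.specialUnitaryGroup (Fin N) ℂ) : Matrix (Fin N) (Fin N) ℂ).trace.re)) μ :=
    (continuous_normSq_trace_mul_weight_su (N := N) β).integrable_of_hasCompactSupport (HasCompactSupport.of_compactSpace _)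
  have hnonneg : ∀ u : Matrix.specialUnitaryGroup (Fin N) ℂ, 0 ≤ ‖((u : Matrix.specialUnitaryGroup (Fin N) ℂ) : Matrix (Fin N) (Fin N) ℂ).trace‖ ^ 2 *
      Real.exp (β * ((u : Matrix.specialUnitaryGroup (Fin N) ℂ) : Matrix (Fin N) (Fin N) ℂ).trace.re) :=
    fun u => mul_nonneg (sq_nonneg _) (Real.exp_pos _).le
  have hopen : IsOpen {u : Matrix.specialUnitaryGroup (Fin N) ℂ |
      0 < ‖((u : Matrix.specialUnitaryGroup (Fin N) ℂ) : Matrix (Fin N) (Fin N) ℂ).trace‖ ^ 2} :=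
    isOpen_lt continuous_const (htr.norm.pow 2)
  have hpos : 0 < μ {u : Matrix.specialUnitaryGroup (Fin N) ℂ |
      0 < ‖((u : Matrix.specialUnitaryGroup (Fin N) ℂ) : Matrix (Fin N) (Fin N) ℂ).trace‖ ^ 2} := by
    refine hopen.measure_pos μ ⟨1, ?_⟩
    simp only [Set.mem_setOf_eq]
    rw [show (((1 : Matrix.specialUnitaryGroup (Fin N) ℂ)) : Matrix (Fin N) (Fin N) ℂ) = 1 from rfl, Matrix.trace_one,
      Fintype.card_fin, Complex.norm_natCast]
    have h1 : (1 : ℝ) ≤ N := by exact_mod_cast hN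
    positivity
  rw [integral_pos_iff_support_of_nonneg hnonneg hint]
  refine hpos.trans_le (measure_mono fun u hu => ?_)
  simp only [Set.mem_setOf_eq] at hu
  simp only [Function.mem_support]
  exact (mul_pos hu (Real.exp_pos _)).ne'

/-- **`−1/(N²−1) < P_adj(β) < 1`** for every real `β` and `N ≥ 2`. -/
theorem specialUnitary_adjointPlaquette_mem_Ioo (hN : 2 ≤ N) (β : ℝ) :
    ((∫ u, ‖((u : Matrix.specialUnitaryGroup (Fin N) ℂ) : Matrix (Fin N) (Fin N) ℂ).trace‖ ^ 2 *
          Real.exp (β * ((u : Matrix.specialUnitaryGroup (Fin N) ℂ) : Matrix (Fin N) (Fin N) ℂ).trace.re)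
          ∂(haarProbability (Matrix.specialUnitaryGroup (Fin N) ℂ))) /
        (∑' q : ℤ, (Matrix.of fun i j : Fin N => besselI (q + (i : ℤ) - (j : ℤ)).natAbs β).det) - 1) / ((N : ℝ) ^ 2 - 1)
      ∈ Set.Ioo (-1 / ((N : ℝ) ^ 2 - 1)) 1 := by
  haveI : NeZero N := ⟨by omega⟩
  have hD : 0 < (∑' q : ℤ, (Matrix.of fun i j : Fin N => besselI (q + (i : ℤ) - (j : ℤ)).natAbs β).det) := by
    rw [← integral_haar_specialUnitaryGroup_fin_exp_mul_trace_re N β]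
    exact integral_exp_pos ((by fun_prop : Continuous fun u : Matrix.specialUnitaryGroup (Fin N) ℂ =>
      Real.exp (β * ((u : Matrix.specialUnitaryGroup (Fin N) ℂ) : Matrix (Fin N) (Fin N) ℂ).trace.re)).integrable_of_hasCompactSupport
        (HasCompactSupport.of_compactSpace _))
  have hN1 : 0 < ((N : ℝ) ^ 2 - 1) := by
    have h2 : (2 : ℝ) ≤ N := by exact_mod_cast hN
    nlinarith
  have hlt := specialUnitary_normSq_trace_weight_lt hN β
  have hpos := specialUnitary_normSq_trace_weight_pos (N := N) (by omega) β
  constructor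
  · rw [div_lt_div_iff_of_pos_right hN1]
    have : 0 < (∫ u, ‖((u : Matrix.specialUnitaryGroup (Fin N) ℂ) : Matrix (Fin N) (Fin N) ℂ).trace‖ ^ 2 *
          Real.exp (β * ((u : Matrix.specialUnitaryGroup (Fin N) ℂ) : Matrix (Fin N) (Fin N) ℂ).trace.re)
          ∂(haarProbability (Matrix.specialUnitaryGroup (Fin N) ℂ))) /
        (∑' q : ℤ, (Matrix.of fun i j : Fin N => besselI (q + (i : ℤ) - (j : ℤ)).natAbs β).det) := div_pos hpos hD
    linarith
  · rw [div_lt_one hN1, sub_lt_iff_lt_add, div_lt_iff₀ hD]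
    linarith

/-- **`|P_adj(β)| < 1`** (`N ≥ 2`). -/
theorem abs_specialUnitary_adjointPlaquette_lt_one (hN : 2 ≤ N) (β : ℝ) :
    |((∫ u, ‖((u : Matrix.specialUnitaryGroup (Fin N) ℂ) : Matrix (Fin N) (Fin N) ℂ).trace‖ ^ 2 *
          Real.exp (β * ((u : Matrix.specialUnitaryGroup (Fin N) ℂ) : Matrix (Fin N) (Fin N) ℂ).trace.re)
          ∂(haarProbability (Matrix.specialUnitaryGroup (Fin N) ℂ))) /
        (∑' q : ℤ, (Matrix.of fun i j : Fin N => besselI (q + (i : ℤ) - (j : ℤ)).natAbs β).det) - 1) / ((N : ℝ) ^ 2 - 1)| < 1 := by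
  obtain ⟨h1, h2⟩ := specialUnitary_adjointPlaquette_mem_Ioo hN β
  have hN1 : 1 ≤ ((N : ℝ) ^ 2 - 1) := by
    have h2' : (2 : ℝ) ≤ N := by exact_mod_cast hN
    nlinarith
  rw [abs_lt]
  refine ⟨lt_of_le_of_lt ?_ h1, h2⟩
  rw [le_div_iff₀ (by linarith), neg_mul, one_mul, neg_le_neg_iff]
  exact hN1

/-- **THE SECOND MOMENT DECORRELATES**: the exact values `1 + (N² − 1)·P_adj(β)ⁿ` of `⟨|tr W_{R×T}|²⟩_β` at area
`n = RT` tend to the Haar value `1` as `n → ∞`, for every real `β` and `N ≥ 2`. -/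
theorem tendsto_specialUnitary_wilsonLoop_secondMoment (hN : 2 ≤ N) (β : ℝ) :
    Tendsto (fun n : ℕ => 1 + ((N : ℝ) ^ 2 - 1) *
      (((∫ u, ‖((u : Matrix.specialUnitaryGroup (Fin N) ℂ) : Matrix (Fin N) (Fin N) ℂ).trace‖ ^ 2 *
          Real.exp (β * ((u : Matrix.specialUnitaryGroup (Fin N) ℂ) : Matrix (Fin N) (Fin N) ℂ).trace.re)
          ∂(haarProbability (Matrix.specialUnitaryGroup (Fin N) ℂ))) /
        (∑' q : ℤ, (Matrix.of fun i j : Fin N => besselI (q + (i : ℤ) - (j : ℤ)).natAbs β).det) - 1) / ((N : ℝ) ^ 2 - 1)) ^ n)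
      atTop (𝓝 1) := by
  have h := abs_specialUnitary_adjointPlaquette_lt_one hN β
  have ht := (tendsto_pow_atTop_nhds_zero_of_abs_lt_one h).const_mul ((N : ℝ) ^ 2 - 1)
  rw [mul_zero] at ht
  simpa using ht.const_add 1

end SUBounds

end Summit.Ventures.LatticeQCDFlow.Scoring
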